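import Literature.MathematicalPhysics.QuantumFieldTheory.Balaban1983to89.T4WilsonDatumBounds
import Literature.MathematicalPhysics.QuantumFieldTheory.Balaban1983to89.T4ExpWindowSmallField
import HarnessLib

/-!
# LINE g18-1 S2β LAPLACE — (WIN-PATH) THE ONE-BOND GEODESIC STAYS IN THE EXACT WINDOW
# (first discharged conjunct of DET-REP-B's PATH rows: `x 0 = U`, `x 1 = V`, smooth, varying only bond `b`, `PlaqSmall θ (x s)` for ALL `s ∈ [0,1]`)

Crux `stmt-QuantumFields-20520` (`…Theses.UnitScaleTilt.FluctuationComparisonRegPrIntL`); cell `ym3-torus` (HUMAN RULING D-0037 — YM₃ on T³ is ladder rung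
R3, not the Clay problem), width seat `ym3-torus-px21` g11; count-neutral helper (`--kind proof --supports stmt-QuantumFields-20520 --as helper`).
Theorems only: 0 `def`, 0 `instance`, 0 `notation`, 0 `sorry`.

WHY.  v11's `DetRepB` (w4-20520 g16, 22:23:23Z∕22:43:13Z) displays, per edge of a window quadrilateral, a path `x : ℝ → fields` with `x 0 = U`, `x 1 = V`,
varying only the bond `b`, smooth in `s`, and INSIDE THE EXACT WINDOW `PlaqSmall θ` for `s ∈ [0,1]` (the chart of record and GAP♯∕EXW are keyed at that
window; a `6θ`-window would need new organ texts).  The cheap interpolation `U_b·exp(sX)` is only `6θ`-small by the triangle inequality; the EXACT window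
needs CONVEXITY.  THIS FILE proves it, in quaternion coordinates (lit `SU2Haar.su2Quat : SU(2) ≃ S³ ⊂ ℍ`):
* §1 trigonometric letters for the spherical interpolation weights `λ₀(s) = sin((1−s)α)∕sin α`, `λ₁(s) = sin(sα)∕sin α`:
  `λ₀² + λ₁² + 2λ₀λ₁cos α = 1` (`norm_slerp`: the interpolant of two unit quaternions at angle `α` is a unit quaternion) and, on `[0,1]`, `λ₀, λ₁ ≥ 0`,
  `λ₀ + λ₁ ≥ 1` (`sin_slerp_weights`: `sin α ≤ sin((1−s)α) + sin(sα)`);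
* §2 ★ `norm_slerp`, ★ `lt_re_conj_comb`, `dist1_lt_iff_re` — THE CONVEXITY OF TWO-SIDED TRANSLATES OF `dist1`-BALLS: the condition «`dist1 (A·g·B) < θ`» reads «`re(a·ĝ·b̂) > 1 − θ²∕2`»
  (lit ✓`norm_sub_one_sq`: `dist1 g² = 2 − 2 re ĝ` on `SU(2)`), an affine half-space condition on `ĝ ∈ S³ ⊂ ℍ ≅ ℝ⁴`; the interpolant `λ₀ p + λ₁ q` with
  `λ₀, λ₁ ≥ 0`, `λ₀ + λ₁ ≥ 1` inherits it from `p` and `q` whenever `1 − θ²∕2 ≥ 0` — for the direct slot `g` AND for the inverted slot `g⁻¹ = ḡ` (conjugation is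
  ℝ-linear);
* §3 ★★ `exists_oneBondPath` — THE LATTICE STATEMENT (w4-20520 g16's shape): for `2 ≤ d`, `θ ≤ 1∕2`, `U, V` θ-small (`PlaqSmall θ`) agreeing off `b`:
  `∃ x : ℝ → GaugeField P j SU(2), ContDiff ℝ ⊤ (coe ∘ x) ∧ x 0 = U ∧ x 1 = V ∧ (∀ s e, e ≠ b → x s e = U e) ∧ ∀ s ∈ Icc 0 1, PlaqSmall θ (x s)`.
  (`U_b` and `V_b` are `2θ`-close through any plaquette containing `b` — this is where `2 ≤ d` enters; the path is `quatToSU2` of the spherical interpolant;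
  every plaquette through `b` contains `b` exactly once, directly or inverted, and its other three bonds are common to `U`, `V`, `x s`.)
HONEST: elementary spherical geometry and lattice bookkeeping; the other PATH∕CLOSE rows of DET-REP-B (minimiser coordinates along the path, charted EXW,
joint smoothness), (LOC), (JAC), DET-REP-A∕B, LAPLACE, S2β and crux 20520 are NOT proved; rung R3 = YM₃ on T³ — NOT d = 4, NOT infinite volume, NOT a mass gap,
NOT Clay.
[cite: Balaban1985Variational, Thm 1 (9)-(10) p.279; Balaban1987RG1, (0.18) p.255; Balaban1985UV3, (11) p.258]
-/

noncomputable section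

open Set Function
open scoped Real Quaternion RealInnerProductSpace Matrix.Norms.L2Operator
open Literature.MathematicalPhysics.QuantumFieldTheory.Balaban1983to89
open Literature.MathematicalPhysics.QuantumLattice (quatMatrix su2Quat quatToSU2 quatMatrix_su2Quat norm_su2Quat quatToSU2_su2Quat
  coe_quatToSU2_of_norm_eq_one quatMatrix_smul)
open Literature.Geometry.GaugeTheory (quatMatrix_add)
open Literature.MathematicalPhysics.QuantumFieldTheory.Balaban1983to89.T4HaarSU2Translate (su2Quat_mul su2Quat_one su2Quat_quatToSU2)
open Literature.MathematicalPhysics.QuantumFieldTheory.Balaban1983to89.T4WilsonLinkAffine (su2Quat_inv)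
open Literature.MathematicalPhysics.QuantumFieldTheory.Balaban1983to89.T4WilsonDatumBounds (norm_su2Quat_sub_sq)
open Literature.MathematicalPhysics.QuantumFieldTheory.Balaban1983to89.T4ExpWindowSmallField (dist1_eq_norm_su2Quat_sub_one norm_sub_one_sq)
open Literature.MathematicalPhysics.QuantumFieldTheory.Balaban1983to89.T4GnomonicWilsonHessian (reTr_eq_re_su2Quat)
open GaugeField (plaqHol)

namespace Summit.QuantumFields.YangMills.Theorems.FluctuationComparisonRegPrIntLS2BetaOneBondGeodesic

/-! ## §1  Trigonometric letters for the spherical interpolation weights -/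

/-- `sin²((1−s)α) + sin²(sα) + 2 sin((1−s)α) sin(sα) cos α = sin²α` (the interpolant of two unit vectors at angle `α` has unit length). [folklore] -/
theorem sin_sq_slerp (α s : ℝ) :
    Real.sin ((1 - s) * α) ^ 2 + Real.sin (s * α) ^ 2 + 2 * Real.sin ((1 - s) * α) * Real.sin (s * α) * Real.cos α = Real.sin α ^ 2 := by
  have h : (1 - s) * α = α - s * α := by ring
  rw [h, Real.sin_sub]
  have h1 := Real.sin_sq_add_cos_sq (s * α)
  have h2 := Real.sin_sq_add_cos_sq α
  linear_combination (Real.sin α) ^ 2 * h1 - (Real.sin (s * α)) ^ 2 * h2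

/-- On `[0,1]`, for `0 ≤ α ≤ π`: `sin((1−s)α) ≥ 0`, `sin(sα) ≥ 0` and `sin α ≤ sin((1−s)α) + sin(sα)` (`sin(a+b) = sin a cos b + cos a sin b ≤ sin a + sin b`). [folklore] -/
theorem sin_slerp_weights {α s : ℝ} (hα0 : 0 ≤ α) (hαπ : α ≤ π) (hs0 : 0 ≤ s) (hs1 : s ≤ 1) :
    0 ≤ Real.sin ((1 - s) * α) ∧ 0 ≤ Real.sin (s * α) ∧ Real.sin α ≤ Real.sin ((1 - s) * α) + Real.sin (s * α) := by
  have ha : 0 ≤ (1 - s) * α := mul_nonneg (by linarith) hα0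
  have ha' : (1 - s) * α ≤ π := by nlinarith
  have hb : 0 ≤ s * α := mul_nonneg hs0 hα0
  have hb' : s * α ≤ π := by nlinarith
  have h1 : 0 ≤ Real.sin ((1 - s) * α) := Real.sin_nonneg_of_nonneg_of_le_pi ha ha'
  have h2 : 0 ≤ Real.sin (s * α) := Real.sin_nonneg_of_nonneg_of_le_pi hb hb'
  refine ⟨h1, h2, ?_⟩
  have h : α = (1 - s) * α + s * α := by ring
  conv_lhs => rw [h]
  rw [Real.sin_add]
  nlinarith [Real.cos_le_one (s * α), Real.cos_le_one ((1 - s) * α), h1, h2]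

/-! ## §2  Spherical interpolation of unit quaternions and the convexity of translated `dist1`-balls -/

/-- ★ **THE SPHERICAL INTERPOLANT IS A UNIT QUATERNION**: for unit `p, q` at angle `α ∈ (0, π)` (`cos α = ⟪p, q⟫`),
`‖(sin((1−s)α)∕sin α)·p + (sin(sα)∕sin α)·q‖ = 1`. [folklore] -/
theorem norm_slerp {p q : ℍ} (hp : ‖p‖ = 1) (hq : ‖q‖ = 1) {α : ℝ} (hsin : 0 < Real.sin α) (hcos : Real.cos α = inner ℝ p q) (s : ℝ) :
    ‖(Real.sin ((1 - s) * α) / Real.sin α) • p + (Real.sin (s * α) / Real.sin α) • q‖ = 1 := by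
  have hsq : ‖(Real.sin ((1 - s) * α) / Real.sin α) • p + (Real.sin (s * α) / Real.sin α) • q‖ ^ 2 = 1 := by
    rw [norm_add_sq_real, norm_smul, norm_smul, hp, hq, real_inner_smul_left, real_inner_smul_right, ← hcos, Real.norm_eq_abs, Real.norm_eq_abs,
      mul_one, mul_one, sq_abs, sq_abs]
    have hne : Real.sin α ≠ 0 := hsin.ne'
    field_simp
    have := sin_sq_slerp α s
    linarith
  have h0 : 0 ≤ ‖(Real.sin ((1 - s) * α) / Real.sin α) • p + (Real.sin (s * α) / Real.sin α) • q‖ := norm_nonneg _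
  nlinarith [hsq, h0]

/-- ★ **CONVEXITY OF TRANSLATED `dist1`-BALLS ALONG THE INTERPOLANT** (affine form): if `re (a·p·c) > κ` and `re (a·q·c) > κ` with `κ ≥ 0`, then for
weights `λ₀, λ₁ ≥ 0` with `λ₀ + λ₁ ≥ 1`, `re (a·(λ₀p + λ₁q)·c) > κ` (used for the direct slot, and with `star p, star q` for the inverted slot — `star` is ℝ-linear).
[folklore] -/
theorem lt_re_conj_comb {a c p q : ℍ} {κ l₀ l₁ : ℝ} (hκ : 0 ≤ κ) (hl₀ : 0 ≤ l₀) (hl₁ : 0 ≤ l₁) (hl : 1 ≤ l₀ + l₁)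
    (hp : κ < (a * p * c).re) (hq : κ < (a * q * c).re) : κ < (a * (l₀ • p + l₁ • q) * c).re := by
  have hlin : (a * (l₀ • p + l₁ • q) * c).re = l₀ * (a * p * c).re + l₁ * (a * q * c).re := by
    rw [mul_add, add_mul, mul_smul_comm, smul_mul_assoc, mul_smul_comm, smul_mul_assoc, Quaternion.re_add, Quaternion.re_smul, Quaternion.re_smul,
      smul_eq_mul, smul_eq_mul]
  rw [hlin]
  -- at least one weight is positive
  rcases lt_or_ge 0 l₀ with h0 | h0
  · have h1 : l₀ * κ < l₀ * (a * p * c).re := mul_lt_mul_of_pos_left hp h0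
    have h2 : l₁ * κ ≤ l₁ * (a * q * c).re := mul_le_mul_of_nonneg_left hq.le hl₁
    nlinarith
  · have hl₀0 : l₀ = 0 := le_antisymm h0 hl₀
    have h1' : 0 < l₁ := by linarith
    have h2 : l₁ * κ < l₁ * (a * q * c).re := mul_lt_mul_of_pos_left hq h1'
    rw [hl₀0]
    nlinarith

/-- **`dist1` IN QUATERNION CURRENCY**: on `SU(2)`, `dist1 g < θ ↔ 1 − θ²∕2 < re ĝ` for `0 ≤ θ` (lit ✓`norm_sub_one_sq`: `dist1 g² = 2 − 2 re ĝ`).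
[cite: Balaban1985UV3, (11) p.258] -/
theorem dist1_lt_iff_re (g : Matrix.specialUnitaryGroup (Fin 2) ℂ) {θ : ℝ} (hθ : 0 ≤ θ) :
    dist1 g < θ ↔ 1 - θ ^ 2 / 2 < (su2Quat g).re := by
  have hd : dist1 g ^ 2 = 2 - 2 * (su2Quat g).re := by
    rw [dist1_eq_norm_su2Quat_sub_one, norm_sub_one_sq (norm_su2Quat g)]
  have hd0 : 0 ≤ dist1 g := GaugeGroup.dist1_nonneg g
  constructor
  · intro h
    have : dist1 g ^ 2 < θ ^ 2 := by nlinarith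
    nlinarith
  · intro h
    have : dist1 g ^ 2 < θ ^ 2 := by nlinarith
    nlinarith [sq_nonneg (dist1 g - θ), sq_nonneg (dist1 g + θ)]

/-! ## §3  The lattice statement: the one-bond geodesic between two θ-small fields is θ-small -/

/-- A lattice step is not trivial: `x + e_μ ≠ x` (`1 ≠ 0` in `ZMod (2L^{m+K−j})`). [cite: Balaban1987RG1, (0.1) p.251 (bookkeeping)] -/
theorem shift_ne_self {P : Params} {j : ℕ} (x : Site P j) (μ : Fin P.d) : x.shift μ ≠ x := by
  intro h
  have h2 := congrFun h μ
  simp only [Site.shift, Function.update_self] at h2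
  exact one_ne_zero (add_eq_left.1 h2)

/-- **TWO θ-SMALL FIELDS AGREEING OFF `b` ARE `2θ`-CLOSE AT `b`** (`2 ≤ d`): through a plaquette containing `b` the two holonomies are `A·U_b^{±1}·B` and
`A·V_b^{±1}·B` with the same `A, B`, so `dist1(U_b·V_b⁻¹) ≤ dist1(U(∂p)) + dist1(V(∂p)) < 2θ`. [cite: Balaban1987RG1, (0.18) p.255] -/
theorem dist1_mul_inv_lt_of_plaqSmall {P : Params} {j : ℕ} (hd : 2 ≤ P.d) {θ : ℝ}
    {U V : GaugeField P j (Matrix.specialUnitaryGroup (Fin 2) ℂ)} (b : PBond P j) (hUV : ∀ e, e ≠ b → U e = V e)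
    (hU : PlaqSmall θ U) (hV : PlaqSmall θ V) : dist1 (U b * (V b)⁻¹) < 2 * θ := by
  -- a direction different from `b.dir`
  obtain ⟨ν, hν⟩ : ∃ ν : Fin P.d, ν ≠ b.dir := by
    by_cases h0 : b.dir = ⟨0, by omega⟩
    · exact ⟨⟨1, by omega⟩, fun h => by rw [h0] at h; exact absurd (congrArg Fin.val h) (by norm_num)⟩
    · exact ⟨⟨0, by omega⟩, fun h => h0 h.symm⟩
  rcases lt_or_gt_of_ne hν with hlt | hgt
  · -- `ν < b.dir`: the plaquette `⟨b.src, ν, b.dir⟩` contains `b` as its fourth (inverted) bond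
    set p : Plaq P j := ⟨b.src, ν, b.dir, hlt⟩ with hp
    have h1 : (⟨b.src, ν⟩ : PBond P j) ≠ b := fun h => hν (congrArg PBond.dir h)
    have h2 : (⟨b.src.shift ν, b.dir⟩ : PBond P j) ≠ b := fun h => shift_ne_self b.src ν (congrArg PBond.src h)
    have h3 : (⟨b.src.shift b.dir, ν⟩ : PBond P j) ≠ b := fun h => hν (congrArg PBond.dir h)
    have hb4 : (⟨p.src, p.ν⟩ : PBond P j) = b := rfl
    have hpU : plaqHol U p = U ⟨b.src, ν⟩ * U ⟨b.src.shift ν, b.dir⟩ * (U ⟨b.src.shift b.dir, ν⟩)⁻¹ * (U b)⁻¹ := rfl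
    have hpV : plaqHol V p = U ⟨b.src, ν⟩ * U ⟨b.src.shift ν, b.dir⟩ * (U ⟨b.src.shift b.dir, ν⟩)⁻¹ * (V b)⁻¹ := by
      show V ⟨b.src, ν⟩ * V ⟨b.src.shift ν, b.dir⟩ * (V ⟨b.src.shift b.dir, ν⟩)⁻¹ * (V b)⁻¹ = _
      rw [hUV _ h1, hUV _ h2, hUV _ h3]
    set L := U ⟨b.src, ν⟩ * U ⟨b.src.shift ν, b.dir⟩ * (U ⟨b.src.shift b.dir, ν⟩)⁻¹ with hL
    have hkey : U b * (V b)⁻¹ = (plaqHol U p)⁻¹ * plaqHol V p := by rw [hpU, hpV]; group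
    rw [hkey]
    calc dist1 ((plaqHol U p)⁻¹ * plaqHol V p) ≤ dist1 (plaqHol U p)⁻¹ + dist1 (plaqHol V p) := GaugeGroup.dist1_mul_le _ _
      _ = dist1 (plaqHol U p) + dist1 (plaqHol V p) := by rw [GaugeGroup.dist1_inv]
      _ < θ + θ := add_lt_add (hU p) (hV p)
      _ = 2 * θ := by ring
  · -- `b.dir < ν`: the plaquette `⟨b.src, b.dir, ν⟩` contains `b` as its first bond
    set p : Plaq P j := ⟨b.src, b.dir, ν, hgt⟩ with hp
    have h2 : (⟨b.src.shift b.dir, ν⟩ : PBond P j) ≠ b := fun h => hν (congrArg PBond.dir h)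
    have h3 : (⟨b.src.shift ν, b.dir⟩ : PBond P j) ≠ b := fun h => shift_ne_self b.src ν (congrArg PBond.src h)
    have h4 : (⟨b.src, ν⟩ : PBond P j) ≠ b := fun h => hν (congrArg PBond.dir h)
    have hpU : plaqHol U p = U b * (U ⟨b.src.shift b.dir, ν⟩ * (U ⟨b.src.shift ν, b.dir⟩)⁻¹ * (U ⟨b.src, ν⟩)⁻¹) := by
      show U ⟨b.src, b.dir⟩ * U ⟨b.src.shift b.dir, ν⟩ * (U ⟨b.src.shift ν, b.dir⟩)⁻¹ * (U ⟨b.src, ν⟩)⁻¹ = _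
      group
    have hpV : plaqHol V p = V b * (U ⟨b.src.shift b.dir, ν⟩ * (U ⟨b.src.shift ν, b.dir⟩)⁻¹ * (U ⟨b.src, ν⟩)⁻¹) := by
      show V ⟨b.src, b.dir⟩ * V ⟨b.src.shift b.dir, ν⟩ * (V ⟨b.src.shift ν, b.dir⟩)⁻¹ * (V ⟨b.src, ν⟩)⁻¹ = _
      rw [hUV _ h2, hUV _ h3, hUV _ h4]
      group
    have hkey : U b * (V b)⁻¹ = plaqHol U p * (plaqHol V p)⁻¹ := by rw [hpU, hpV]; group
    rw [hkey]
    calc dist1 (plaqHol U p * (plaqHol V p)⁻¹) ≤ dist1 (plaqHol U p) + dist1 (plaqHol V p)⁻¹ := GaugeGroup.dist1_mul_le _ _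
      _ = dist1 (plaqHol U p) + dist1 (plaqHol V p) := by rw [GaugeGroup.dist1_inv]
      _ < θ + θ := add_lt_add (hU p) (hV p)
      _ = 2 * θ := by ring

/-- ★★ **(WIN-PATH) THE ONE-BOND GEODESIC STAYS IN THE EXACT WINDOW**: for `2 ≤ d`, `θ ≤ 1∕2`, and two `θ`-small gauge fields `U, V` (`PlaqSmall θ`) that agree
off one bond `b`, there is a path `x : ℝ → fields`, smooth in `s` (through the matrix coordinates), with `x 0 = U`, `x 1 = V`, `x s = U` off `b` for every `s`,
and `PlaqSmall θ (x s)` for EVERY `s ∈ [0,1]` — the spherical interpolant of `U_b`, `V_b` in `SU(2) ≅ S³`; the window condition on each plaquette through `b`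
is an affine half-space condition in `ℍ ≅ ℝ⁴`, inherited by the interpolant (§2).  The first PATH row of v11's `DetRepB` (w4-20520 g16), discharged.
[cite: Balaban1985Variational, Thm 1 (9)-(10) p.279; Balaban1987RG1, (0.18) p.255] -/
theorem exists_oneBondPath {P : Params} {j : ℕ} (hd : 2 ≤ P.d) {θ : ℝ} (hθ : θ ≤ 1 / 2)
    {U V : GaugeField P j (Matrix.specialUnitaryGroup (Fin 2) ℂ)} (b : PBond P j) (hUV : ∀ e, e ≠ b → U e = V e)
    (hU : PlaqSmall θ U) (hV : PlaqSmall θ V) :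
    ∃ x : ℝ → GaugeField P j (Matrix.specialUnitaryGroup (Fin 2) ℂ),
      ContDiff ℝ ⊤ (fun s => fun e => ((x s e : Matrix.specialUnitaryGroup (Fin 2) ℂ) : Matrix (Fin 2) (Fin 2) ℂ)) ∧
      x 0 = U ∧ x 1 = V ∧ (∀ s e, e ≠ b → x s e = U e) ∧ ∀ s ∈ Set.Icc (0 : ℝ) 1, PlaqSmall θ (x s) := by
  classical
  -- `θ > 0` (there is a plaquette), and the two fields are `2θ`-close at `b`
  have hθ0 : 0 < θ := by
    have ⟨ν, hν⟩ : ∃ ν : Fin P.d, ν ≠ b.dir := by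
      by_cases h0 : b.dir = ⟨0, by omega⟩
      · exact ⟨⟨1, by omega⟩, fun h => by rw [h0] at h; exact absurd (congrArg Fin.val h) (by norm_num)⟩
      · exact ⟨⟨0, by omega⟩, fun h => h0 h.symm⟩
    rcases lt_or_gt_of_ne hν with hlt | hgt
    · exact lt_of_le_of_lt (GaugeGroup.dist1_nonneg _) (hU ⟨b.src, ν, b.dir, hlt⟩)
    · exact lt_of_le_of_lt (GaugeGroup.dist1_nonneg _) (hU ⟨b.src, b.dir, ν, hgt⟩)
  have hclose := dist1_mul_inv_lt_of_plaqSmall hd b hUV hU hV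
  -- the degenerate case `U_b = V_b`: the constant path
  by_cases hbb : U b = V b
  · have hUVall : U = V := funext fun e => if he : e = b then (by rw [he, hbb]) else hUV e he
    refine ⟨fun _ => U, contDiff_const, rfl, hUVall, fun _ _ _ => rfl, fun _ _ => hU⟩
  -- quaternion coordinates
  set p : ℍ := su2Quat (U b) with hp_def
  set q : ℍ := su2Quat (V b) with hq_def
  have hp1 : ‖p‖ = 1 := norm_su2Quat _
  have hq1 : ‖q‖ = 1 := norm_su2Quat _
  -- `⟪p, q⟫ = 1 − dist1(U_b V_b⁻¹)²∕2 ∈ (1/2, 1)`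
  have hpq_sq : ‖p - q‖ ^ 2 = dist1 (U b * (V b)⁻¹) ^ 2 := by
    rw [hp_def, hq_def, norm_su2Quat_sub_sq, reTr_eq_re_su2Quat, dist1_eq_norm_su2Quat_sub_one, norm_sub_one_sq (norm_su2Quat _)]
    ring
  have hinner : inner ℝ p q = 1 - ‖p - q‖ ^ 2 / 2 := by
    rw [real_inner_eq_norm_mul_self_add_norm_mul_self_sub_norm_sub_mul_self_div_two, hp1, hq1]; ring
  have hc_lt : inner ℝ p q < 1 := by
    have hne : p ≠ q := fun h => hbb (by
      have := congrArg quatToSU2 h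
      rwa [hp_def, hq_def, quatToSU2_su2Quat, quatToSU2_su2Quat] at this)
    have : 0 < ‖p - q‖ := norm_pos_iff.2 (sub_ne_zero.2 hne)
    rw [hinner]; nlinarith
  have hc_gt : 1 / 2 < inner ℝ p q := by
    have h1 : dist1 (U b * (V b)⁻¹) ^ 2 < 1 := by
      have h0 := GaugeGroup.dist1_nonneg (U b * (V b)⁻¹)
      nlinarith
    rw [hinner, hpq_sq]; linarith
  -- the angle
  set α : ℝ := Real.arccos (inner ℝ p q) with hα_def
  have hcos : Real.cos α = inner ℝ p q := Real.cos_arccos (by linarith) hc_lt.le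
  have hα0 : 0 < α := Real.arccos_pos.2 hc_lt
  have hαπ : α ≤ π := Real.arccos_le_pi _
  have hsin : 0 < Real.sin α := by
    rw [hα_def, Real.sin_arccos]
    exact Real.sqrt_pos.2 (by nlinarith)
  -- the weights and the interpolant
  set l₀ : ℝ → ℝ := fun s => Real.sin ((1 - s) * α) / Real.sin α with hl₀
  set l₁ : ℝ → ℝ := fun s => Real.sin (s * α) / Real.sin α with hl₁
  set π' : ℝ → ℍ := fun s => l₀ s • p + l₁ s • q with hπ'
  have hπ1 : ∀ s, ‖π' s‖ = 1 := fun s => norm_slerp hp1 hq1 hsin hcos s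
  have hπ0 : ∀ s, π' s ≠ 0 := fun s h => by have := hπ1 s; rw [h, norm_zero] at this; exact zero_ne_one this
  have hsu : ∀ s, su2Quat (quatToSU2 (π' s)) = π' s := fun s => by rw [su2Quat_quatToSU2 (hπ0 s), hπ1 s, inv_one, one_smul]
  -- the path
  set x : ℝ → GaugeField P j (Matrix.specialUnitaryGroup (Fin 2) ℂ) := fun s => Function.update U b (quatToSU2 (π' s)) with hx
  have hxb : ∀ s, x s b = quatToSU2 (π' s) := fun s => Function.update_self _ _ _
  have hxe : ∀ s e, e ≠ b → x s e = U e := fun s e he => Function.update_of_ne he _ _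
  refine ⟨x, ?_, ?_, ?_, hxe, ?_⟩
  · -- smoothness through the matrix coordinates: at `b` the matrix is `λ₀(s)·U_b + λ₁(s)·V_b`
    have hl₀s : ContDiff ℝ ⊤ l₀ := ((contDiff_const.sub contDiff_id).mul contDiff_const).sin.div_const _
    have hl₁s : ContDiff ℝ ⊤ l₁ := (contDiff_id.mul contDiff_const).sin.div_const _
    refine contDiff_pi.2 fun e => ?_
    by_cases he : e = b
    · subst he
      have hform : (fun s => ((x s e : Matrix.specialUnitaryGroup (Fin 2) ℂ) : Matrix (Fin 2) (Fin 2) ℂ)) =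
          fun s => ((l₀ s : ℝ) : ℂ) • quatMatrix p + ((l₁ s : ℝ) : ℂ) • quatMatrix q := by
        funext s
        rw [hxb s, coe_quatToSU2_of_norm_eq_one (hπ1 s)]
        show quatMatrix (l₀ s • p + l₁ s • q) = _
        rw [quatMatrix_add, quatMatrix_smul, quatMatrix_smul]
      rw [hform]
      exact ((Complex.ofRealCLM.contDiff.comp hl₀s).smul contDiff_const).add ((Complex.ofRealCLM.contDiff.comp hl₁s).smul contDiff_const)
    · have hform : (fun s => ((x s e : Matrix.specialUnitaryGroup (Fin 2) ℂ) : Matrix (Fin 2) (Fin 2) ℂ)) = fun _ => ((U e : _) : Matrix (Fin 2) (Fin 2) ℂ) := by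
        funext s; rw [hxe s e he]
      rw [hform]; exact contDiff_const
  · -- `x 0 = U`
    have h0 : π' 0 = p := by
      simp only [hπ', hl₀, hl₁, sub_zero, one_mul, zero_mul, Real.sin_zero, zero_div, zero_smul, add_zero, div_self hsin.ne', one_smul]
    funext e
    by_cases he : e = b
    · rw [he, hxb, h0, hp_def, quatToSU2_su2Quat]
    · exact hxe 0 e he
  · -- `x 1 = V`
    have h1 : π' 1 = q := by
      simp only [hπ', hl₀, hl₁, sub_self, zero_mul, one_mul, Real.sin_zero, zero_div, zero_smul, zero_add, div_self hsin.ne', one_smul]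
    funext e
    by_cases he : e = b
    · rw [he, hxb, h1, hq_def, quatToSU2_su2Quat]
    · rw [hxe 1 e he]; exact hUV e he
  · -- THE WINDOW along the path
    intro s hs pl
    obtain ⟨hw₀, hw₁, hwsum⟩ := sin_slerp_weights hα0.le hαπ hs.1 hs.2
    have hl₀0 : 0 ≤ l₀ s := div_nonneg hw₀ hsin.le
    have hl₁0 : 0 ≤ l₁ s := div_nonneg hw₁ hsin.le
    have hlsum : 1 ≤ l₀ s + l₁ s := by
      show 1 ≤ Real.sin ((1 - s) * α) / Real.sin α + Real.sin (s * α) / Real.sin α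
      rw [← add_div, le_div_iff₀ hsin]; linarith
    have hκ : 0 ≤ 1 - θ ^ 2 / 2 := by nlinarith
    -- the four bonds of the plaquette
    set b₁ : PBond P j := ⟨pl.src, pl.μ⟩ with hb₁
    set b₂ : PBond P j := ⟨pl.src.shift pl.μ, pl.ν⟩ with hb₂
    set b₃ : PBond P j := ⟨pl.src.shift pl.ν, pl.μ⟩ with hb₃
    set b₄ : PBond P j := ⟨pl.src, pl.ν⟩ with hb₄
    have hμν : pl.μ ≠ pl.ν := pl.hμν.ne
    have h12 : b₁ ≠ b₂ := fun h => hμν (congrArg PBond.dir h)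
    have h13 : b₁ ≠ b₃ := fun h => shift_ne_self pl.src pl.ν (congrArg PBond.src h).symm
    have h14 : b₁ ≠ b₄ := fun h => hμν (congrArg PBond.dir h)
    have h23 : b₂ ≠ b₃ := fun h => hμν (congrArg PBond.dir h).symm
    have h24 : b₂ ≠ b₄ := fun h => shift_ne_self pl.src pl.μ (congrArg PBond.src h)
    have h34 : b₃ ≠ b₄ := fun h => hμν (congrArg PBond.dir h)
    have hplaq : ∀ W : GaugeField P j (Matrix.specialUnitaryGroup (Fin 2) ℂ), plaqHol W pl = W b₁ * W b₂ * (W b₃)⁻¹ * (W b₄)⁻¹ := fun W => rfl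
    -- quaternion reading of a plaquette
    have hQ : ∀ W : GaugeField P j (Matrix.specialUnitaryGroup (Fin 2) ℂ),
        su2Quat (plaqHol W pl) = su2Quat (W b₁) * su2Quat (W b₂) * star (su2Quat (W b₃)) * star (su2Quat (W b₄)) := by
      intro W; rw [hplaq, su2Quat_mul, su2Quat_mul, su2Quat_mul, su2Quat_inv, su2Quat_inv]
    -- the window in quaternion currency at the two endpoints
    have hUre : 1 - θ ^ 2 / 2 < (su2Quat (plaqHol U pl)).re := (dist1_lt_iff_re _ hθ0.le).1 (hU pl)
    have hVre : 1 - θ ^ 2 / 2 < (su2Quat (plaqHol V pl)).re := (dist1_lt_iff_re _ hθ0.le).1 (hV pl)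
    rw [dist1_lt_iff_re _ hθ0.le]
    -- quaternions of the bonds of `x s`: `π' s` at `b`, those of `U` (= those of `V`) elsewhere
    have hxq : ∀ e, su2Quat (x s e) = if e = b then π' s else su2Quat (U e) := by
      intro e
      by_cases he : e = b
      · rw [if_pos he, he, hxb, hsu]
      · rw [if_neg he, hxe s e he]
    have hVq : ∀ e, e ≠ b → su2Quat (V e) = su2Quat (U e) := fun e he => by rw [hUV e he]
    by_cases hmem : b = b₁ ∨ b = b₂ ∨ b = b₃ ∨ b = b₄
    · rw [hQ] at hUre hVre ⊢
      rcases hmem with rfl | rfl | rfl | rfl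
      · -- `b = b₁` (direct slot): `Q(x s) = (π' s) · R`
        rw [hxq, hxq, hxq, hxq, if_pos rfl, if_neg h12.symm, if_neg h13.symm, if_neg h14.symm]
        rw [hVq _ h12.symm, hVq _ h13.symm, hVq _ h14.symm] at hVre
        have := lt_re_conj_comb (a := 1) (c := su2Quat (U b₂) * star (su2Quat (U b₃)) * star (su2Quat (U b₄))) hκ hl₀0 hl₁0 hlsum
          (p := p) (q := q) (by simpa only [one_mul, mul_assoc, hp_def] using hUre) (by simpa only [one_mul, mul_assoc, hq_def] using hVre)
        simpa only [one_mul, mul_assoc, hπ'] using this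
      · -- `b = b₂` (direct slot)
        rw [hxq, hxq, hxq, hxq, if_neg h12, if_pos rfl, if_neg h23.symm, if_neg h24.symm]
        rw [hVq _ h12, hVq _ h23.symm, hVq _ h24.symm] at hVre
        have := lt_re_conj_comb (a := su2Quat (U b₁)) (c := star (su2Quat (U b₃)) * star (su2Quat (U b₄))) hκ hl₀0 hl₁0 hlsum
          (p := p) (q := q) (by simpa only [mul_assoc, hp_def] using hUre) (by simpa only [mul_assoc, hq_def] using hVre)
        simpa only [mul_assoc, hπ'] using this
      · -- `b = b₃` (inverted slot): `star` is ℝ-linear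
        rw [hxq, hxq, hxq, hxq, if_neg h13, if_neg h23, if_pos rfl, if_neg h34.symm]
        rw [hVq _ h13, hVq _ h23, hVq _ h34.symm] at hVre
        have := lt_re_conj_comb (a := su2Quat (U b₁) * su2Quat (U b₂)) (c := star (su2Quat (U b₄))) hκ hl₀0 hl₁0 hlsum
          (p := star p) (q := star q) (by simpa only [mul_assoc, hp_def] using hUre) (by simpa only [mul_assoc, hq_def] using hVre)
        rw [hπ']
        simpa only [mul_assoc, star_add, Quaternion.star_smul] using this
      · -- `b = b₄` (inverted slot)
        rw [hxq, hxq, hxq, hxq, if_neg h14, if_neg h24, if_neg h34, if_pos rfl]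
        rw [hVq _ h14, hVq _ h24, hVq _ h34] at hVre
        have := lt_re_conj_comb (a := su2Quat (U b₁) * su2Quat (U b₂) * star (su2Quat (U b₃))) (c := 1) hκ hl₀0 hl₁0 hlsum
          (p := star p) (q := star q) (by simpa only [mul_one, mul_assoc, hp_def] using hUre) (by simpa only [mul_one, mul_assoc, hq_def] using hVre)
        rw [hπ']
        simpa only [mul_one, mul_assoc, star_add, Quaternion.star_smul] using this
    · -- `b` is not a bond of the plaquette: nothing moves
      simp only [not_or] at hmem
      obtain ⟨n1, n2, n3, n4⟩ := hmem
      have : plaqHol (x s) pl = plaqHol U pl := by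
        rw [hplaq, hplaq, hxe s b₁ (Ne.symm n1), hxe s b₂ (Ne.symm n2), hxe s b₃ (Ne.symm n3), hxe s b₄ (Ne.symm n4)]
      rw [this]
      exact hUre

end Summit.QuantumFields.YangMills.Theorems.FluctuationComparisonRegPrIntLS2BetaOneBondGeodesic

end
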